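import Literature.IUT.HodgeArakelov.MonoThetaProjectiveLimOneToy
import HarnessLib

/-!
# [IUTchII] Prop. 1.5 (i)′: the REPAIRED decl of record `Prop15_i' R A B` is STILL a SCHEMA — universal-closure
# certificate by the lim¹ twin (proof-only; FACT-LIST row F-0670)

S. Mochizuki, *Inter-universal Teichmüller theory II*, kurims manuscript (Dec. 2020), §1, Prop. 1.5 (i) p. 29: "Such a
projective system [of mono-theta environments `… → M^Θ_{M'} → M^Θ_M → …`] is uniquely determined, up to isomorphism, by
`X̲̲_k` [cf. Remark 1.5.1 below; the discrete rigidity property of [EtTh], Corollary 2.19, (ii)]"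
[claim: Mochizuki2012, status: disputed] (IUTchII §1 Prop 1.5 (i), kurims p.29); S. Mochizuki, *The étale theta function
…* [EtTh], Cor. 2.19 (ii) (discrete rigidity), Def. 2.13 (ii) (morphisms of mono-theta environments).  abc-iut cell,
block F (FACT-proving wave, D-0078 rung A2.C), seat abc-iut-f-130 (gen 8), FACT-LIST row **F-0670** `Prop15_i'` (label
«conditional»; LF-KERNEL-STATUS 2026-08-27T05:18Z: LABEL-OPEN, 5 conditional closers / 17 conditional instances, no
deciding kernel event).  PROOF-ONLY companion (0 `def`, 0 `instance`) of abc-iut-L6-t19's repair file of record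
`MonoThetaProjectiveR.lean` (`Prop15_i'`, `IsMonoThetaCompatible`, `ModelFamily.Reductions`) over the toy of
`MonoThetaProjectiveLimOne{Monomials,Groups,Toy}.lean`; nothing of record is edited or re-typed.

WHAT THE REPAIR FIXED AND WHAT IT DID NOT.  abc-iut-w6-d014's `not_forall_prop15_i` refuted the frozen `Prop15_i` by
KILLING transitions; the repair `Prop15_i'` demands that every transition be, up to isomorphisms of mono-theta
environments at both ends, the model reduction — per ARROW — and concludes ONE compatible family of isomorphisms.  The
passage "arrow-wise ⟹ simultaneous" is exactly [EtTh] Cor. 2.19 (ii) for GENUINE mono-theta environments (whose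
automorphisms lift along the tower).  Over the free interface it FAILS: take the model system `A` (`trans := red`) and
its TWIN `B` (`trans_{M∣M'} := U^{c_d} ∘ red_{M∣M'}`, `d = v₂(M') − v₂(M)`, `c_d = (3^d−1)/2`, `U` = relabelling the
monomials by `x`), over the junk model family `Π_M = ℤ^{(Mon)} × Ẑ × ℤ/M` whose theta section portion is the family of
cones `{T̂_m}` and whose reductions act on monomials by `φ : x ↦ x³, v₀ ↦ x, v_{i+1} ↦ v_i` (so `red ∘ U = U³ ∘ red`:
the twist `U` DESCENDS but does NOT LIFT).  Both are `IsMonoThetaCompatible` (`B`'s arrow `h` is straightened by the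
isomorphism `U^{−c_d}` of the model at the bottom).  A compatible family `e_M : A_M ⥲ B_M` of isomorphisms of mono-theta
environments would permute the cones preserving inclusion, hence act on the chain `{T̂_{x^n}}` (= the cones whose
up-family is totally ordered) by a DEGREE SHIFT `s_M ∈ ℤ`; compatibility along `2^k ∣ 2^{k+1}` forces
`s_k = 3 s_{k+1} + 1`, i.e. `2 s_0 + 1 = 3^n (2 s_n + 1)` for every `n` — impossible in `ℤ` (it is the non-vanishing of
`lim¹` of `ℤ ←×3− ℤ ←×3− ⋯`; over `ℤ₃` the solution `s ≡ −1/2` exists, which is why no finite truncation obstructs).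

* `LimOneToy.isMonoThetaCompatible_sys a` — every `sys a` is a system OF MONO-THETA ENVIRONMENTS in the repaired sense;
* `LimOneToy.exists_shift` — the degree shift of an isomorphism of mono-theta environments of the model;
* `LimOneToy.not_prop15_i_sys` — `¬ Prop15_i A B`;
* **`not_forall_prop15_i'`** — the CLOSED certificate: the universal closure of F-0670 is FALSE;
* `prop15_i'_sys_self` — the instance form `Prop15_i' R A A` HOLDS at the toy (INHABITED; the genuine instances of the
  tree — `prop15_i'_of_cyclotomeTower_modelχ`, `…_modelχq`, `…_modelTate`, `prop15_i'_of_cor218_iv`, … — BY NAME).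

READING for the label pen / L6 lineage: the residual HYPOTHESIS under which `Prop15_i'` holds is a LIFTING property of
isomorphisms of mono-theta environments along the model reductions (equivalently, vanishing of the tower's `lim¹`) —
print's [EtTh] Cor. 2.18 (iv) / 2.19 (ii) content — which the interface `ModelFamily.Reductions` does not record.
HONEST FRAMING: a refuted universal closure is a statement about OUR typing at a junk tower, not about print's Prop. 1.5
(i); the [IUTchII] claim key `Mochizuki2012` is DISPUTED (D-0012) and nothing of it is asserted; no side is taken on
[IUTchIII] Cor. 3.12; typed ≠ proved; nothing here asserts abc proved or refuted.
-/

noncomputable section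

namespace Literature.IUT.HodgeArakelov

namespace LimOneToy

/-! ## Both systems are systems OF MONO-THETA ENVIRONMENTS in the repaired sense -/

/-- For every twist parameter `a`, every transition of `sys a` is — up to the isomorphism `U^{−a·c_d}` of the
model at the bottom and the identity at the top — the model reduction: `IsMonoThetaCompatible`. [claim: Mochizuki2012, status: disputed] (IUTchII §1 Prop 1.5 (i), kurims p.29) -/
theorem isMonoThetaCompatible_sys (a : ℤ) : (sys a).IsMonoThetaCompatible reductions := by
  intro M M' h
  refine ⟨MonoThetaEnv.Iso.refl _, isoShift M (-(a * cexp (gap h))), fun y => ?_⟩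
  show (isoShift M (-(a * cexp (gap h)))).iso (transOf a h y) = transOf 0 h y
  rw [isoShift_apply, transOf, transOf, Phom_apply, Phom_apply, Phom_apply, castMul_refl, zero_mul]
  refine Prod.ext (Prod.ext ?_ rfl) rfl
  show ((Rhom 0 _).comp (Rhom _ _)) y.1.1 = Rhom _ 0 y.1.1
  rw [Rhom_comp, zero_add, pow_zero, one_mul, neg_add_cancel]

/-! ## No compatible family of isomorphisms `A ≅ B`: the degree-shift invariant -/

/-- STEP 1: an isomorphism of mono-theta environments of the model permutes the cones — every `T̂_m` is carried to
some `T̂_{m'}`, and every `T̂_{m'}` is hit. [claim: Mochizuki2012, status: disputed] (IUTchII §1 Prop 1.5 (i), kurims p.29) -/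
theorem exists_map_coneHat_eq {M : ℕ+} (ε : MonoThetaEnv.Iso (family.modelEnv M) (family.modelEnv M)) (m : Mon) :
    ∃ m' : Mon, (coneHat M m).map (isoHom ε) = coneHat M m' := by
  have : (coneHat M m).map (isoHom ε) ∈ Set.range (coneHat M) := by
    rw [← image_map_isoHom ε]
    exact ⟨coneHat M m, ⟨m, rfl⟩, rfl⟩
  obtain ⟨m', hm'⟩ := this
  exact ⟨m', hm'.symm⟩

/-- STEP 1 (onto): every `T̂_{m'}` is the image of some `T̂_m`. [claim: Mochizuki2012, status: disputed] (IUTchII §1 Prop 1.5 (i), kurims p.29) -/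
theorem exists_eq_map_coneHat {M : ℕ+} (ε : MonoThetaEnv.Iso (family.modelEnv M) (family.modelEnv M)) (m' : Mon) :
    ∃ m : Mon, (coneHat M m).map (isoHom ε) = coneHat M m' := by
  have : coneHat M m' ∈ (fun H : Subgroup (Car M) => H.map (isoHom ε)) '' Set.range (coneHat M) := by
    rw [image_map_isoHom ε]
    exact ⟨m', rfl⟩
  obtain ⟨_, ⟨m, rfl⟩, hm⟩ := this
  exact ⟨m, hm⟩

/-- STEP 2: the induced map on monomials is an order-automorphism, hence preserves the pure powers of `x` (the
monomials below which the order is total) and acts on their exponents by an order-automorphism of `ℤ`, i.e. by a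
TRANSLATION — the DEGREE SHIFT `s(ε) ∈ ℤ`. [claim: Mochizuki2012, status: disputed] (IUTchII §1 Prop 1.5 (i), kurims p.29) -/
theorem exists_shift {M : ℕ+} (ε : MonoThetaEnv.Iso (family.modelEnv M) (family.modelEnv M)) :
    ∃ s : ℤ, ∀ n : ℤ, (coneHat M (n, 0)).map (isoHom ε) = coneHat M (n + s, 0) := by
  classical
  -- the induced permutation `ĝ` of monomials
  choose ĝ hĝ using exists_map_coneHat_eq ε
  -- `ĝ` is an order embedding …
  have hle : ∀ m₁ m₂ : Mon, m₁ ≤ m₂ ↔ ĝ m₁ ≤ ĝ m₂ := by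
    intro m₁ m₂
    rw [← coneHat_le_coneHat_iff (M := M), ← coneHat_le_coneHat_iff (M := M), ← hĝ, ← hĝ]
    exact (Subgroup.map_le_map_iff_of_injective (isoHom_injective ε)).symm
  -- … and onto
  have hsurj : Function.Surjective ĝ := by
    intro m'
    obtain ⟨m, hm⟩ := exists_eq_map_coneHat ε m'
    exact ⟨m, coneHat_injective M ((hĝ m).symm.trans hm)⟩
  -- so it preserves "the order is total below `m`", i.e. the pure powers of `x`
  have htot : ∀ m : Mon, m.2 = 0 ↔ (ĝ m).2 = 0 := by
    intro m
    rw [← total_below_iff, ← total_below_iff]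
    constructor
    · intro H m₁' m₂' h₁ h₂
      obtain ⟨m₁, rfl⟩ := hsurj m₁'
      obtain ⟨m₂, rfl⟩ := hsurj m₂'
      rcases H m₁ m₂ ((hle _ _).mpr h₁) ((hle _ _).mpr h₂) with h | h
      · exact Or.inl ((hle _ _).mp h)
      · exact Or.inr ((hle _ _).mp h)
    · intro H m₁ m₂ h₁ h₂
      rcases H (ĝ m₁) (ĝ m₂) ((hle _ _).mp h₁) ((hle _ _).mp h₂) with h | h
      · exact Or.inl ((hle _ _).mpr h)
      · exact Or.inr ((hle _ _).mpr h)
  -- the induced map on exponents of `x`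
  let g : ℤ → ℤ := fun n => (ĝ (n, 0)).1
  have hg : ∀ n : ℤ, ĝ (n, 0) = (g n, 0) := fun n => Prod.ext rfl ((htot (n, 0)).mp rfl)
  have hgsurj : Function.Surjective g := by
    intro n'
    obtain ⟨m, hm⟩ := hsurj (n', 0)
    have hm2 : m.2 = 0 := (htot m).mpr (by rw [hm])
    refine ⟨m.1, ?_⟩
    have : m = (m.1, 0) := Prod.ext rfl hm2
    show (ĝ (m.1, 0)).1 = n'
    rw [← this, hm]
  have hgle : ∀ a b : ℤ, a ≤ b ↔ g a ≤ g b := by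
    intro a b
    have := hle (a, 0) (b, 0)
    rw [hg, hg] at this
    simpa [Prod.le_def] using this
  obtain ⟨s, hs⟩ := int_orderAuto_eq_add g hgsurj hgle
  exact ⟨s, fun n => by rw [hĝ, hg, hs]⟩

/-- **No compatible family of isomorphisms of mono-theta environments `A ≅ B` exists**: along the chain
`2^k ∣ 2^{k+1}` the degree shifts `s_k` of such a family would satisfy `s_k = 3 s_{k+1} + 1`, i.e.
`2 s_0 + 1 = 3^n (2 s_n + 1)` for all `n` — impossible in `ℤ` (`lim¹ ≠ 0` of `ℤ ←×3− ℤ ←×3− ⋯`). [claim: Mochizuki2012, status: disputed] (IUTchII §1 Prop 1.5 (i), kurims p.29) -/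
theorem not_prop15_i_sys : ¬ Prop15_i (sys 0) (sys 1) := by
  rintro ⟨e, he⟩
  -- the degree shifts along the chain
  have hshift := fun k => exists_shift (e (twoPow k))
  choose s hs using hshift
  -- the recursion `s_k = 3 s_{k+1} + 1`
  have hrec : ∀ k, s k = 3 * s (k + 1) + 1 := by
    intro k
    have hfun : (isoHom (e (twoPow k))).comp (transOf 0 (twoPow_dvd k)) =
        (transOf 1 (twoPow_dvd k)).comp (isoHom (e (twoPow (k + 1)))) :=
      MonoidHom.ext fun y => he (twoPow_dvd k) y
    have key := congrArg (fun F => (coneHat (twoPow (k + 1)) (0, 0)).map F) hfun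
    simp only [← Subgroup.map_map] at key
    rw [transOf, transOf, gap_twoPow, map_coneHat, gmap_one_pure, hs k, hs (k + 1), map_coneHat,
      gmap_one_pure] at key
    have key' := congrArg Prod.fst (coneHat_injective _ key)
    simp only [cexp_one, Nat.cast_one] at key'
    omega
  -- hence `2 s_0 + 1 = 3^n (2 s_n + 1)` for all `n`
  have hclosed : ∀ n : ℕ, 2 * s 0 + 1 = 3 ^ n * (2 * s n + 1) := by
    intro n
    induction n with
    | zero => simp
    | succ n ih => rw [ih, hrec n, pow_succ]; ring
  -- impossible: `|2 s_0 + 1| ≥ 3^n` for all `n`, but `2 s_0 + 1` is a fixed integer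
  have hodd : ∀ n : ℕ, 2 * s n + 1 ≠ 0 := fun n h => by omega
  have hbig : ∀ n : ℕ, (3 : ℤ) ^ n ≤ |2 * s 0 + 1| := by
    intro n
    rw [hclosed n, abs_mul, abs_pow, abs_of_pos (by norm_num : (0 : ℤ) < 3)]
    have : (1 : ℤ) ≤ |2 * s n + 1| := Int.one_le_abs (hodd n)
    nlinarith [pow_pos (by norm_num : (0 : ℤ) < 3) n]
  have h1 : (3 : ℤ) ^ (2 * s 0 + 1).natAbs ≤ |2 * s 0 + 1| := hbig _
  have h2 : ((2 * s 0 + 1).natAbs : ℤ) < (3 : ℤ) ^ (2 * s 0 + 1).natAbs := by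
    exact_mod_cast Nat.lt_pow_self (by norm_num : 1 < 3)
  rw [Int.abs_eq_natAbs] at h1
  omega

end LimOneToy

/-- **IUTchII:Prop1.5(i)′ — the REPAIRED decl of record is STILL a schema** (F-0670): there are a [IUTchII] §1
setting, a model family with model reductions `R`, and two projective systems `A`, `B` over it, BOTH systems of
mono-theta environments in the repaired sense (`IsMonoThetaCompatible R`), with NO compatible family of isomorphisms
`A ≅ B`; so `Prop15_i' R A B` is false and the universal closure of `Prop15_i'` is FALSE. [claim: Mochizuki2012, status: disputed] (IUTchII §1 Prop 1.5 (i), kurims p.29) -/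
theorem not_forall_prop15_i' :
    ¬ ∀ (S : ThetaSetting.{0}) (F : ModelFamily S) (R : F.Reductions) (A B : MonoThetaProjSystem F),
        Prop15_i' R A B :=
  fun h => LimOneToy.not_prop15_i_sys
    (h _ _ LimOneToy.reductions (LimOneToy.sys 0) (LimOneToy.sys 1)
      (LimOneToy.isMonoThetaCompatible_sys 0) (LimOneToy.isMonoThetaCompatible_sys 1))

/-- The instance form at the toy: `Prop15_i' R A A` HOLDS (the identity family), so the schema is inhabited here too
(besides the genuine instances `prop15_i'_of_cyclotomeTower_modelχ` / `_modelTate` / `…` of the tree, BY NAME). [claim: Mochizuki2012, status: disputed] (IUTchII §1 Prop 1.5 (i), kurims p.29) -/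
theorem prop15_i'_sys_self (a : ℤ) : Prop15_i' LimOneToy.reductions (LimOneToy.sys a) (LimOneToy.sys a) :=
  fun _ _ => ⟨fun _ => MonoThetaEnv.Iso.refl _, fun _ _ => rfl⟩

end Literature.IUT.HodgeArakelov

end
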